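import Summits.Ventures.HodgeRepro2.T5CircleWeightSpaces
import Summits.Ventures.HodgeRepro2.T5HaarCircle

/-!
# T5CircleFourier — multiplicities as Fourier coefficients; Parseval; «each weight once»

Support (seat p1, blind lane) for route/T5-N4-p5.md v10 (N4.3 = (R3), rows P2′ «the SO(2)-weights are
exactly {3, 5, 7, …}, each once» and «Schur orthogonality cross-check») — the explicit form, with the
Haar measure `dθ/2π` of T5HaarCircle, of the abstract multiplicity formula of T5CircleWeights:

* `finrank_weightSpace_eq_intervalIntegral` — `dim V_n = (2π)⁻¹ ∫₀^{2π} χ_ρ(e^{iθ}) e^{−inθ} dθ`: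
  the multiplicity of the weight `n` is the `n`-th Fourier coefficient of the character;
* `integral_character_mul_conj_eq_sum_sq` — PARSEVAL: `∫ |χ_ρ|² dθ/2π = Σ_n (dim V_n)²`;
* `forall_finrank_le_one_iff` — «each weight occurs at most once» ⟺ `∫ |χ_ρ|² dθ/2π = #weights`.

Honest scope: nothing about (N), U(1,1), the infinite-dimensional π₃⁺ or its weights {3, 5, 7, …};
`Circle` stands for SO(2) through T5CayleySU11's matrices, not re-proved here.
-/

namespace Summit.Ventures.HodgeRepro2.T5CircleFourier

open Summit.Ventures.HodgeRepro2 T5CircleWeights T5CircleWeightSpaces T5HaarCircle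
open MeasureTheory Real Complex

section Rep

variable [MeasurableSpace Circle] [BorelSpace Circle]

/-- `z ↦ z ^ m · conj (z ^ n)` is integrable for `haarCircle` (continuous on a compact space). -/
theorem integrable_zpow_mul_conj_zpow (m n : ℤ) :
    Integrable (fun z : Circle => (z : ℂ) ^ m * (starRingEnd ℂ) ((z : ℂ) ^ n)) haarCircle := by
  have hc : Continuous fun z : Circle => (z : ℂ) ^ m * (starRingEnd ℂ) ((z : ℂ) ^ n) := by
    have h1 : Continuous fun z : Circle => (z : ℂ) := continuous_subtype_val
    exact (h1.zpow₀ m fun z => Or.inl (Circle.coe_ne_zero z)).mul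
      (Complex.continuous_conj.comp (h1.zpow₀ n fun z => Or.inl (Circle.coe_ne_zero z)))
  exact hc.integrable_of_hasCompactSupport (HasCompactSupport.of_compactSpace _)

variable {V : Type*} [NormedAddCommGroup V] [InnerProductSpace ℂ V] [FiniteDimensional ℂ V]
  (ρ : Circle →* V →L[ℂ] V) (hρ : Continuous ρ)

include hρ in
/-- THE MULTIPLICITY OF THE WEIGHT `n` IS THE `n`-TH FOURIER COEFFICIENT OF THE CHARACTER:
`dim V_n = (2π)⁻¹ ∫₀^{2π} χ_ρ(e^{iθ}) e^{−inθ} dθ`. -/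
theorem finrank_weightSpace_eq_intervalIntegral (n : ℤ) :
    (Module.finrank ℂ (T5WeightSpaces.weightSpace ρ (zpowChar n)) : ℂ) =
      (2 * π : ℂ)⁻¹ * ∫ θ in (0 : ℝ)..2 * π,
        T5SchurOrthogonality.character ρ (Circle.exp θ) * Complex.exp (-(n : ℂ) * (θ * I)) := by
  rw [finrank_weightSpace_zpowChar_eq_integral ρ hρ haarCircle n, integral_haarCircle,
    Complex.real_smul]
  push_cast
  congr 1
  apply intervalIntegral.integral_congr
  intro θ _
  simp only [← Complex.exp_int_mul, T5TorusCharacters.conj_exp_int_mul]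

include hρ in
/-- PARSEVAL for the character: `∫ χ_ρ · conj χ_ρ ∂haarCircle = Σ_{n ∈ weights ρ} (dim V_n)²`. -/
theorem integral_character_mul_conj_eq_sum_sq :
    ∫ z, T5SchurOrthogonality.character ρ z * (starRingEnd ℂ) (T5SchurOrthogonality.character ρ z)
        ∂haarCircle =
      ∑ n ∈ weights ρ, ((Module.finrank ℂ (T5WeightSpaces.weightSpace ρ (zpowChar n)) : ℂ)) ^ 2 := by
  set d : ℤ → ℂ := fun n => (Module.finrank ℂ (T5WeightSpaces.weightSpace ρ (zpowChar n)) : ℂ)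
    with hd
  have hconj : ∀ n, (starRingEnd ℂ) (d n) = d n := fun n => by simp [hd]
  have hχ : ∀ z : Circle, T5SchurOrthogonality.character ρ z *
      (starRingEnd ℂ) (T5SchurOrthogonality.character ρ z) =
      ∑ m ∈ weights ρ, ∑ n ∈ weights ρ,
        (d m * d n) * ((z : ℂ) ^ m * (starRingEnd ℂ) ((z : ℂ) ^ n)) := by
    intro z
    rw [character_eq_sum_finrank_zpow ρ hρ z, map_sum, Finset.sum_mul_sum]
    refine Finset.sum_congr rfl fun m _ => Finset.sum_congr rfl fun n _ => ?_
    rw [map_mul, hconj]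
    ring
  simp_rw [hχ]
  rw [integral_finsetSum _ fun m _ =>
    integrable_finsetSum _ fun n _ => (integrable_zpow_mul_conj_zpow m n).const_mul _]
  simp_rw [integral_finsetSum _ fun n _ => (integrable_zpow_mul_conj_zpow _ n).const_mul _,
    integral_const_mul, integral_zpow_mul_conj_zpow]
  refine Finset.sum_congr rfl fun m hm => ?_
  simp only [mul_ite, mul_one, mul_zero, Finset.sum_ite_eq, if_pos hm, sq, hd]

include hρ in
/-- «EACH WEIGHT OCCURS AT MOST ONCE» ⟺ `∫ |χ_ρ|² ∂haarCircle = #weights`: the classical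
Schur-orthogonality criterion for multiplicity one, read off from the character. -/
theorem forall_finrank_le_one_iff :
    (∀ n : ℤ, Module.finrank ℂ (T5WeightSpaces.weightSpace ρ (zpowChar n)) ≤ 1) ↔
      ∫ z, T5SchurOrthogonality.character ρ z *
          (starRingEnd ℂ) (T5SchurOrthogonality.character ρ z) ∂haarCircle =
        ((weights ρ).card : ℂ) := by
  rw [integral_character_mul_conj_eq_sum_sq ρ hρ]
  set d : ℤ → ℕ := fun n => Module.finrank ℂ (T5WeightSpaces.weightSpace ρ (zpowChar n)) with hd
  have hcast : (∑ n ∈ weights ρ, ((d n : ℂ)) ^ 2 = ((weights ρ).card : ℂ)) ↔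
      ∑ n ∈ weights ρ, d n ^ 2 = (weights ρ).card := by
    constructor
    · intro h; exact_mod_cast h
    · intro h; exact_mod_cast h
  change (∀ n, d n ≤ 1) ↔ ∑ n ∈ weights ρ, ((d n : ℂ)) ^ 2 = ((weights ρ).card : ℂ)
  rw [hcast, Finset.card_eq_sum_ones, eq_comm,
    Finset.sum_eq_sum_iff_of_le fun n hn => ?_]
  · constructor
    · intro h n hn
      have h1 : 1 ≤ d n := Nat.one_le_iff_ne_zero.2 ((mem_weights_iff_finrank_ne_zero ρ).1 hn)
      have h2 : d n = 1 := le_antisymm (h n) h1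
      rw [h2]
      norm_num
    · intro h n
      by_cases hn : n ∈ weights ρ
      · have := h n hn
        have h2 : d n ^ 2 = 1 := this.symm
        rcases (Nat.pow_eq_one.1 h2) with h3 | h3
        · omega
        · omega
      · have : d n = 0 := by
          by_contra h0
          exact hn ((mem_weights_iff_finrank_ne_zero ρ).2 h0)
        omega
  · have h1 : 1 ≤ d n := Nat.one_le_iff_ne_zero.2 ((mem_weights_iff_finrank_ne_zero ρ).1 hn)
    calc 1 ≤ d n := h1
      _ ≤ d n ^ 2 := by nlinarith

end Rep

end Summit.Ventures.HodgeRepro2.T5CircleFourier
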